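import Literature.NumberTheory.GaloisRepresentations.TateDualLimitLocalPairing
import Literature.NumberTheory.GaloisCohomology.PoitouTateSelmerStructures
import HarnessLib

/-!
# The sum formula `∑_{v ∈ Σ} ⟪x_v, y_v⟫_v = 0` for the `Λ`-adic local pairings (Greenberg 2010 §3.1:
# "`G` and `G*` are orthogonal"), from Poitou–Tate at a finite level (theorems only)

Topic `NumberTheory/GaloisRepresentations`; namespace
`Literature.NumberTheory.GaloisRepresentations.DiscreteGaloisModule.TorsionLayers`; THEOREMS ONLY
(no definition, no named fact, no `sorry`, no instance).  Lane «SUR-Λ» of cell `bsd-eis` (road memo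
`SUR-LAMBDA-ROAD-w5g9.md` §2 ★(3.1.1-easy), brick C5b), `--supports stmt-BirchSwinnertonDyer-19032`.

MATHEMATICS (R. Greenberg, Kyoto J. Math. 50 (2010) §3.1 p. 14): with `P = ∏_{v∈Σ} H¹(K_v, D)`,
`P* = ∏_{v∈Σ} H¹(K_v, T*)` and the pairing `P × P* → ℚ_p/ℤ_p` "defined by the local pairings (5)",
"the submodules `G` and `G*` are orthogonal complements of each other" (images of the global classes
`H¹(K_Σ/K, D)`, `H¹(K_Σ/K, T*)`); the EASY half `G ⊥ G*` — all that Prop. 3.1.1's injection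
`S_{𝓛*}(K,T*)/Ш¹ ↪ coker(φ_𝓛)^∨` uses — is the reciprocity `∑_{v∈Σ} ⟨x_v, y_v⟩_v = 0` of
Poitou–Tate (Milne I 4.10 (b), `Im β¹ ⊆ Ker γ¹`) for the finite level through which `x` factors.
This file proves it in the currency of `TateDualLimitLocalPairing.lean`, for an arbitrary family
`inv k : LocalInvariants K (p^k)` satisfying levelwise the Poitou–Tate vanishing
(`LocalInvariants.SumLocalTermEqZero`) and the orthogonality of unramified classes
(`LocalInvariants.UnramifiedOrthogonal`, Milne I 2.6) — for THE canonical family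
`LocalInvariants.canonical K (p^k)` both are tree theorems (`sumLocalTermEqZero_canonical`,
`unramifiedOrthogonal_of_isPerfect_allLevels canonical_isPerfect`; Summits-side):

* `localization_map_layerSubtype` — `loc_v ((D_k ⊆ D)_* x_k) = (D_k ⊆ D)_* (loc_v x_k)`
  (naturality of localisation in the coefficients, degree `1`, cocycle level);
* `localProj_map_restrict` — `(loc_v y)_k = loc_v (y_k)` for `y ∈ H¹_cont(Γ_K, T*)`, its level
  component `y_k = H¹(proj_k) y` and the restriction `loc_v` along `Γ_{K_v} → Γ_K` (written as
  Mathlib's `ContinuousCohomology.map (absGaloisRestrict K K_v) (𝟙-like) 1`);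
* **`sum_limitPairing_eq_zero_of_level`** — for a finite set `Σ` of places containing the
  archimedean ones and those above `p`, a GLOBAL level-`k` class `x_k ∈ H¹(Γ_K, D_k)` and a global
  `y_k ∈ H¹(Γ_K, Hom(D_k, μ_{p^k}))`, both UNRAMIFIED at the finite places outside `Σ` (as is `D_k`),
  and local classes `yv v ∈ H¹_cont(K_v, T*)` whose level-`k` components are `loc_v y_k`:
  `∑_{v ∈ Σ} ⟪loc_v ((D_k ⊆ D)_* x_k), yv v⟫_v = 0`.  (The limit pairing of `(D_k ⊆ D)_* (loc_v x_k)`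
  only sees the level-`k` component of `yv v` — the level formula `limitPairing_localSubtypeMap` —,
  so the sum is `ι_{p^k} (∑_{v∈Σ} ⟨x_k, y_k⟩_v) = ι_{p^k}(0)`, the local terms off `Σ` vanishing by
  Milne I 2.6.)  Consumers: `x_k` = a lift of `x ∈ H¹(K_Σ/K, D)` through `H¹(G_Σ, D_k)` (the tree's
  `ContinuousRep.exists_cohomologyMap_eq_one` for the compact `G_Σ`, inflated — unramified off `Σ`
  by construction), `y_k` = `H¹(proj_k)` of `y ∈ S_{𝓛*}(K, T*)`, `yv v = loc_v y`
  (`localProj_map_restrict`).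

HONESTY: the Poitou–Tate input is consumed levelwise as a hypothesis on `inv`; nothing about SUR,
Greenberg's propositions or BSD is proved here.  AI formalisation, weaker than expert review; the
statements are established only by the kernel check.

## References
* R. Greenberg, *Surjectivity of the global-to-local map defining a Selmer group*, Kyoto J. Math.
  50 (2010) 853–888, §3.1 p. 14 (`G`, `G*` orthogonal), Prop. 3.1.1. [Greenberg2010]
* J. S. Milne, *Arithmetic Duality Theorems*, 2nd ed. (2006), I Thm. 4.10 (b), I Thm. 2.6.
  [MilneADT2006]
-/

noncomputable section

open Function CategoryTheory NumberField IsDedekindDomain Field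
open _root_.TopRep _root_.ContRepresentation _root_.ContinuousCohomology
open scoped ContRepresentation
open Literature.NumberTheory.GaloisRepresentations.DiscreteGaloisModule
open Literature.NumberTheory.GaloisCohomology (LocalInvariants)
open Literature.AnabelianGeometry.AbsoluteAnabelian.Prop121vii (zmodToQmodZ)

namespace Literature.NumberTheory.GaloisRepresentations

namespace DiscreteGaloisModule.TorsionLayers

variable {K : Type} [Field K] [NumberField K] {D : Type} [AddCommGroup D] [TopologicalSpace D]
  [DiscreteTopology D] {τ : DiscreteGaloisModule K D} {p : ℕ} (E : τ.TorsionLayers p) (v : Place K)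

/-! ### §1. Naturality of localisation in the coefficients and in the level projections -/

/-- **`loc_v ((D_k ⊆ D)_* x_k) = (D_k ⊆ D)_* (loc_v x_k)`**: localisation at `v` commutes with the map
induced by the inclusion of a layer (degree `1`, on cocycles both are `σ ↦ x_k(σ|_K) ∈ D_k ⊆ D`).
[cite: SerreGaloisCohomology1997, I §2.4] -/
theorem localization_map_layerSubtype (k : ℕ) (xk : galoisCohomology (E.layerRep k) 1) :
    galoisCohomology.localization τ v 1 (galoisCohomology.map (E.layerSubtypeHom k).hom 1 xk) =
      E.localSubtypeMap v k (galoisCohomology.localization (E.layerRep k) v 1 xk) := by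
  obtain ⟨ψ, rfl⟩ := oneCocycleClass_surjective _ xk
  change (ContinuousCohomology.map _ _ 1).hom ((ContinuousCohomology.map _ _ 1).hom _) =
    (ContinuousCohomology.map _ _ 1).hom ((ContinuousCohomology.map _ _ 1).hom _)
  erw [map_oneCocycleClass, map_oneCocycleClass, map_oneCocycleClass, map_oneCocycleClass]
  exact congrArg _ (Subtype.ext (ContinuousMap.ext fun _ => rfl))

/-- **`(loc_v y)_k = loc_v (y_k)`** for `y ∈ H¹_cont(Γ_K, T*)`: the level-`k` component of the
restriction of `y` to `Γ_{K_v}` is the localisation of the global level-`k` component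
`y_k = H¹(proj_k) y ∈ H¹(Γ_K, Hom(D_k, μ_{p^k}))` (on cocycles both are `σ ↦ (y(σ|_K))_k`).
[cite: SerreGaloisCohomology1997, I §2.4] [cite: NeukirchSchmidtWingberg2008, II §7 Thm 2.7.5] -/
theorem localProj_map_restrict (k : ℕ) (y : continuousCohomology 1 E.dualSystem.limitRep.toTopRep) :
    E.localProj v k ((ContinuousCohomology.map (absGaloisRestrict K (Place.Completion v))
        (X := E.dualSystem.limitRep.toTopRep) (Y := (E.localDualSystem v).limitRep.toTopRep)
        (TopRep.ofHom ⟨ContinuousLinearMap.id ℤ _, fun _ => rfl⟩) 1).hom y) =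
      galoisCohomology.localization (E.layerDualRep k) v 1
        ((cohomologyMap (E.dualSystem.projHom k) 1).hom y) := by
  obtain ⟨ψ, rfl⟩ := oneCocycleClass_surjective _ y
  rw [localProj_apply]
  change (ContinuousCohomology.map _ _ 1).hom ((ContinuousCohomology.map _ _ 1).hom _) =
    (ContinuousCohomology.map _ _ 1).hom ((ContinuousCohomology.map _ _ 1).hom _)
  erw [map_oneCocycleClass, map_oneCocycleClass, map_oneCocycleClass, map_oneCocycleClass]
  exact congrArg _ (Subtype.ext (ContinuousMap.ext fun _ => rfl))

/-! ### §2. The sum formula at a level -/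

variable [NeZero p] (inv : ∀ k : ℕ, LocalInvariants K (p ^ k))

/-- **One local term**: for a level-`k` global class `x_k` and a local `T*`-class `yv` whose level-`k`
component is `loc_v y_k`, `⟪loc_v ((D_k ⊆ D)_* x_k), yv⟫_v = ι_{p^k} ⟨x_k, y_k⟩_v`, the local term
of the finite-level Poitou–Tate sum (`LocalInvariants.localTerm`). [cite: Greenberg2010, §3.1 (9) p. 14] -/
theorem limitPairing_localization_eq_localTerm {v : Place K} (hinv : InvLevelLaw inv v) {k : ℕ}
    (xk : galoisCohomology (E.layerRep k) 1) (yk : galoisCohomology (E.layerDualRep k) 1)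
    (yv : continuousCohomology 1 (E.localDualSystem v).limitRep.toTopRep)
    (hyv : E.localProj v k yv = galoisCohomology.localization (E.layerDualRep k) v 1 yk) :
    E.limitPairing inv v hinv
        (galoisCohomology.localization τ v 1 (galoisCohomology.map (E.layerSubtypeHom k).hom 1 xk)) yv =
      haveI := E.finite k
      zmodToQmodZ (p ^ k) ((inv k).localTerm (E.layerRep k) v xk yk) := by
  haveI := E.finite k
  rw [localization_map_layerSubtype, limitPairing_localSubtypeMap hinv, levelPairing_apply, hyv]
  rfl

/-- **The sum formula `∑_{v ∈ Σ} ⟪loc_v x, y_v⟫_v = 0`** (Greenberg 2010 §3.1: the images `G` of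
`H¹(K_Σ/K, D)` and `G*` of `H¹(K_Σ/K, T*)` are orthogonal under (9)) for a global class
`x = (D_k ⊆ D)_* x_k` coming from the level `k`, GRANTED at the level `k` the Poitou–Tate vanishing
`∑_v ⟨·,·⟩_v = 0` (`SumLocalTermEqZero`, Milne I 4.10 (b)) and the orthogonality of unramified classes
(`UnramifiedOrthogonal`, Milne I 2.6) for `inv k`: here `Σ` is a finite set of places containing all
archimedean places and all places above `p`, off which `D_k`, `x_k` and `y_k` are unramified, and
`yv v` are local `T*`-classes with level-`k` components `loc_v y_k`.
[cite: Greenberg2010, §3.1 p. 14] [cite: MilneADT2006, Ch. I, Thm. 4.10(b)] [cite: MilneADT2006, Ch. I, Thm. 2.6] -/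
theorem sum_limitPairing_eq_zero_of_level (Sig : Finset (Place K))
    (hinv : ∀ v ∈ Sig, InvLevelLaw inv v) {k : ℕ}
    (hPT : (inv k).SumLocalTermEqZero) (hUO : (inv k).UnramifiedOrthogonal)
    (hinf : ∀ w : InfinitePlace K, (Sum.inl w : Place K) ∈ Sig)
    (hp : ∀ w : HeightOneSpectrum (𝓞 K), ((p : ℕ) : 𝓞 K) ∈ w.asIdeal → (Sum.inr w : Place K) ∈ Sig)
    (hram : ∀ w : HeightOneSpectrum (𝓞 K), (Sum.inr w : Place K) ∉ Sig →
      GaloisRep.IsUnramifiedAt w (E.layerRep k))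
    (xk : galoisCohomology (E.layerRep k) 1) (yk : galoisCohomology (E.layerDualRep k) 1)
    (hx : ∀ w : HeightOneSpectrum (𝓞 K), (Sum.inr w : Place K) ∉ Sig →
      galoisCohomology.localization (E.layerRep k) (Sum.inr w) 1 xk ∈
        unramifiedSubgroup (GaloisRep.toLocal w (E.layerRep k)) 1)
    (hy : ∀ w : HeightOneSpectrum (𝓞 K), (Sum.inr w : Place K) ∉ Sig →
      haveI := E.finite k
      galoisCohomology.localization (E.layerDualRep k) (Sum.inr w) 1 yk ∈
        unramifiedSubgroup (GaloisRep.toLocal w ((E.layerRep k).tateDual (p ^ k))) 1)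
    (yv : ∀ v : Place K, continuousCohomology 1 (E.localDualSystem v).limitRep.toTopRep)
    (hyv : ∀ v ∈ Sig, E.localProj v k (yv v) = galoisCohomology.localization (E.layerDualRep k) v 1 yk) :
    ∑ v ∈ Sig.attach, E.limitPairing inv v.1 (hinv v.1 v.2)
        (galoisCohomology.localization τ v.1 1 (galoisCohomology.map (E.layerSubtypeHom k).hom 1 xk))
        (yv v.1) = 0 := by
  haveI := E.finite k
  -- each term is `ι_{p^k}` of the finite-level local term
  have hterm : ∀ v : Sig, E.limitPairing inv v.1 (hinv v.1 v.2)
      (galoisCohomology.localization τ v.1 1 (galoisCohomology.map (E.layerSubtypeHom k).hom 1 xk))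
      (yv v.1) = zmodToQmodZ (p ^ k) ((inv k).localTerm (E.layerRep k) v.1 xk yk) := fun v =>
    E.limitPairing_localization_eq_localTerm inv (hinv v.1 v.2) xk yk (yv v.1) (hyv v.1 v.2)
  rw [Finset.sum_congr rfl fun v _ => hterm v, ← map_sum,
    Finset.sum_attach Sig fun v => (inv k).localTerm (E.layerRep k) v xk yk]
  -- Poitou–Tate at the level `k`: the local terms vanish off `Σ` (unramified classes are orthogonal)
  rw [hPT (E.layerRep k) (fun m => E.pow_smul_eq_zero m) xk yk Sig ?_, map_zero]
  intro v hv
  rcases v with w | w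
  · exact absurd (hinf w) hv
  · have hpw : (((p ^ k : ℕ) : ℕ) : 𝓞 K) ∉ w.asIdeal := by
      rw [Nat.cast_pow]
      exact fun h => hv (hp w (w.isPrime.mem_of_pow_mem k h))
    have horth := (hUO (E.layerRep k) (fun m => E.pow_smul_eq_zero m) w hpw (hram w hv)).1
    have hmem : galoisCohomology.localization (E.layerDualRep k) (Sum.inr w) 1 yk ∈
        (inv k).dualLocalCondition (E.layerRep k) (Sum.inr w)
          (unramifiedSubgroup (GaloisRep.toLocal w (E.layerRep k)) 1) := by
      rw [horth]
      exact hy w hv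
    have hmem' := (LocalInvariants.mem_dualLocalCondition_iff (inv k) (E.layerRep k) (Sum.inr w)
      (unramifiedSubgroup (GaloisRep.toLocal w (E.layerRep k)) 1)
      (galoisCohomology.localization (E.layerDualRep k) (Sum.inr w) 1 yk)).mp hmem
    rw [LocalInvariants.localTerm_apply]
    exact hmem' _ (hx w hv)

end DiscreteGaloisModule.TorsionLayers

end Literature.NumberTheory.GaloisRepresentations
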